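import Summits.QuantumFields.YangMills.Theorems.SwapVirialDeficitBlowUpFollowerMinimiserChart
import Summits.QuantumFields.YangMills.Theorems.WeakCouplingRatesColdBoxGnomonic
import HarnessLib

/-!
# THE GNOMONIC FOLLOWER CHART IS FROBENIUS-COMPARABLE: `2|v|²/(1+|v|²) ≤ ‖gno⁺(v) − 1‖²_F ≤ 2|v|²` — the `hΨ` (`κ = 1` on the unit sup-box) of
# ✓`follower_coercivity_of_taylor[_twisted]`, follower GROWTH in gnomonic coordinates, and the minimiser's SUP-BOX `|η_f|² ≤ 2304·L⁶·m`
# (free-hands support of ⟨stmt-QuantumFields-24197⟩ `SwapVirialDeficit.SwapGluedStiffness`; bricks W3∕W6 (T1) of LEAD ym-line-sfw-p2 g97's steep-window plan)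

With `gno⁺(v) = quatToSU2 (gnoLetter true v) = (1,v)/√(1+|v|²)`, `‖U − 1‖²_F = 2·(2 − Re tr U)` (unit quaternions) and the single-link cost bounds
✓`WeakCouplingRates.two_sub_trace_re_gnomonic_bounds` (`|v|²/(1+|v|²) ≤ 2 − Re tr gno⁺(v) ≤ |v|²`):
* `frobNorm_sub_one_sq_eq_two_mul_cost`, ★ `gnoFollower_frobNorm_sq_bounds` (`2|v|²/(1+|v|²) ≤ ‖gno⁺(v) − 1‖²_F ≤ 2|v|²`);
* ★ `normSq3_le_frobNorm_sq_gnoFollower` (`|v|² ≤ 1 ⟹ |v|² ≤ ‖gno⁺(v) − 1‖²_F`: `κ = 1`), ★ `normSq3_le_of_frobNorm_gnoFollower_le` (`‖gno⁺(v) − 1‖_F ≤ r`, `r² ≤ 1 ⟹ |v|² ≤ r²`);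
* ★★ `sum_normSq3_le_sum_frobNorm_sq` — THE `hΨ` OF ✓`follower_coercivity_of_taylor[_twisted]` for the gnomonic follower chart on the unit sup-box:
  `Σ_f |η_f|² ≤ Σ_f ‖gno⁺(η_f) − 1‖²_F`; `sum_frobNorm_sq_le_two_mul_sum_normSq3` (the converse, factor `2`, everywhere);
* ★★★ `gnoFollower_growth[_twisted]` — FOLLOWER GROWTH IN GNOMONIC COORDINATES, every base point, every sector: `(2304·L⁶·|Fol L|)⁻¹·Σ_f|η_f|² ≤ F̂_z(C, gno⁺(η))` on the unit
  sup-box (✓`chartDeficit[_twisted]_ge_sum_follower_frobNorm_sq`);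
* ★★ `gnoFollower_normSq3_le_of_chartDeficit[_twisted]` — conversely every point with `2304L⁶·F̂_z ≤ 1` has ALL follower coordinates in the box `|η_f|² ≤ 2304·L⁶·F̂_z(C, gno⁺(η))`
  (✓`chartBox_of_chartDeficit[_twisted]`): in particular a gnomonic minimiser (✓`exists_follower_minimiser_gnomonic[_twisted]`) sits in the sup-box of radius `48L³√m`
  — LEAD's (T1) «the minimiser sits in a sup-box of radius `ρ = 96L³√F̂_max`».

HONEST LABEL: bookkeeping on landed inequalities; ⟨24197⟩ (window-uniform) ∕ ⟨24196⟩ ∕ ⟨24194⟩ ∕ ⟨24497⟩ OPEN; own crux ⟨22884⟩ OPEN (blocked-on ⟨19935⟩); no crux, rung of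
record or summit is proved; the Yang–Mills mass gap is NOT proved; no summit is proved by a line.  THEOREMS ONLY (0 `def`, 0 `sorry`), standard axioms.
Width seat ym-line-sfw-p2-w3 g65 (cell ym-idea-1, free hands), `--supports stmt-QuantumFields-24197`.  References: [cite: Luscher1983, §2]; [folklore].
-/

set_option autoImplicit false

noncomputable section

open MeasureTheory Quaternion
open scoped BigOperators Quaternion
open Literature.MathematicalPhysics.QuantumFieldTheory hiding SU2
open Literature.MathematicalPhysics.QuantumLattice
open Literature.MathematicalPhysics.QuantumFieldTheory.Balaban1983to89.T4ExpWindowSmallField (norm_sub_one_sq)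

namespace Summit.QuantumFields.YangMills.Theorems.SwapVirialDeficit.BlowUpRing

open Summit.QuantumFields.YangMills.Theorems.FemtoTransferGap
open Summit.QuantumFields.YangMills.Theorems.FemtoTransferGap.TT
open Summit.QuantumFields.YangMills.Theorems.FemtoTransferGap.TwoLattice.Flat (fd)
open Summit.QuantumFields.YangMills.Theorems.VirialFluxGap.RingDeficit
open Summit.QuantumFields.YangMills.Theorems.SwapVirialDeficit.SwapRing
open Summit.QuantumFields.YangMills.Theorems.SwapVirialDeficit.Gnomonic (normSq3 normSq3_nonneg)
open Summit.QuantumFields.YangMills.Theorems.ToronValleyVolume.Lojasiewicz (fd_sq_eq_two_mul)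
open Summit.QuantumFields.YangMills.Theorems.WeakCouplingRates (two_sub_trace_re_gnomonic_bounds)

variable {L : ℕ} [NeZero L]

/-! ## §1 One letter -/

omit [NeZero L] in
/-- `‖U − 1‖²_F = 2·(2 − Re tr U)` on `SU(2)`. [folklore] -/
theorem frobNorm_sub_one_sq_eq_two_mul_cost (U : SU2) :
    frobNorm ((U : Matrix (Fin 2) (Fin 2) ℂ) - 1) ^ 2 = 2 * (2 - ((U : Matrix (Fin 2) (Fin 2) ℂ).trace).re) := by
  have h1 : fd U 1 ^ 2 = 2 * ‖su2Quat U - su2Quat 1‖ ^ 2 := fd_sq_eq_two_mul U 1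
  rw [su2Quat_one, norm_sub_one_sq (norm_su2Quat U)] at h1
  have hfd : fd U 1 = frobNorm ((U : Matrix (Fin 2) (Fin 2) ℂ) - 1) := by simp only [fd, OneMemClass.coe_one]
  rw [← hfd, h1, su2_trace_re_eq_quat]

omit [NeZero L] in
/-- `gnoLetter true v = gnomonicQuat v`. [folklore] -/
theorem gnoLetter_true (v : Fin 3 → ℝ) : gnoLetter true v = gnomonicQuat v := by simp [gnoLetter]

omit [NeZero L] in
/-- `normSq3 v = Σ v_i²`. [folklore] -/
theorem normSq3_eq_sum (v : Fin 3 → ℝ) : normSq3 v = ∑ i, v i ^ 2 := rfl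

omit [NeZero L] in
/-- ★ **The gnomonic follower letter is Frobenius-comparable**: `2|v|²/(1+|v|²) ≤ ‖gno⁺(v) − 1‖²_F ≤ 2|v|²`. [folklore] -/
theorem gnoFollower_frobNorm_sq_bounds (v : Fin 3 → ℝ) :
    2 * normSq3 v / (1 + normSq3 v) ≤ frobNorm (((quatToSU2 (gnoLetter true v) : SU2) : Matrix (Fin 2) (Fin 2) ℂ) - 1) ^ 2 ∧
      frobNorm (((quatToSU2 (gnoLetter true v) : SU2) : Matrix (Fin 2) (Fin 2) ℂ) - 1) ^ 2 ≤ 2 * normSq3 v := by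
  rw [frobNorm_sub_one_sq_eq_two_mul_cost, gnoLetter_true, normSq3_eq_sum]
  obtain ⟨h1, h2⟩ := two_sub_trace_re_gnomonic_bounds v
  constructor
  · rw [mul_div_assoc]; exact mul_le_mul_of_nonneg_left h1 (by norm_num)
  · exact mul_le_mul_of_nonneg_left h2 (by norm_num)

omit [NeZero L] in
/-- ★ **`κ = 1` on the unit box**: `|v|² ≤ 1 ⟹ |v|² ≤ ‖gno⁺(v) − 1‖²_F`. [folklore] -/
theorem normSq3_le_frobNorm_sq_gnoFollower (v : Fin 3 → ℝ) (hv : normSq3 v ≤ 1) :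
    normSq3 v ≤ frobNorm (((quatToSU2 (gnoLetter true v) : SU2) : Matrix (Fin 2) (Fin 2) ℂ) - 1) ^ 2 := by
  have h := (gnoFollower_frobNorm_sq_bounds v).1
  have ht := normSq3_nonneg v
  have h2 : normSq3 v ≤ 2 * normSq3 v / (1 + normSq3 v) := by
    rw [le_div_iff₀ (by linarith)]; nlinarith
  exact h2.trans h

omit [NeZero L] in
/-- ★ **Box ⟹ coordinates**: `‖gno⁺(v) − 1‖_F ≤ r` with `r² ≤ 1` ⟹ `|v|² ≤ r²`. [folklore] -/
theorem normSq3_le_of_frobNorm_gnoFollower_le (v : Fin 3 → ℝ) {r : ℝ} (hr : r ^ 2 ≤ 1)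
    (h : frobNorm (((quatToSU2 (gnoLetter true v) : SU2) : Matrix (Fin 2) (Fin 2) ℂ) - 1) ≤ r) : normSq3 v ≤ r ^ 2 := by
  have hlow := (gnoFollower_frobNorm_sq_bounds v).1
  have ht := normSq3_nonneg v
  have h0 : 0 ≤ frobNorm (((quatToSU2 (gnoLetter true v) : SU2) : Matrix (Fin 2) (Fin 2) ℂ) - 1) := frobNorm_nonneg _
  have hsq : frobNorm (((quatToSU2 (gnoLetter true v) : SU2) : Matrix (Fin 2) (Fin 2) ℂ) - 1) ^ 2 ≤ r ^ 2 := pow_le_pow_left₀ h0 h 2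
  have h1 : 2 * normSq3 v / (1 + normSq3 v) ≤ r ^ 2 := hlow.trans hsq
  rw [div_le_iff₀ (by linarith)] at h1
  nlinarith

/-! ## §2 All followers: the `hΨ` of the follower coercivity and the growth in gnomonic coordinates -/

/-- ★★ **THE `hΨ` OF ✓`follower_coercivity_of_taylor[_twisted]` FOR THE GNOMONIC FOLLOWER CHART** (`κ = 1` on the unit sup-box):
`(∀ f, |η_f|² ≤ 1) ⟹ Σ_f |η_f|² ≤ Σ_f ‖gno⁺(η_f) − 1‖²_F`. [folklore] -/
theorem sum_normSq3_le_sum_frobNorm_sq (η : Fol L → Fin 3 → ℝ) (hη : ∀ f, normSq3 (η f) ≤ 1) :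
    ∑ f, normSq3 (η f) ≤ ∑ f : Fol L, frobNorm (((quatToSU2 (gnoLetter true (η f)) : SU2) : Matrix (Fin 2) (Fin 2) ℂ) - 1) ^ 2 :=
  Finset.sum_le_sum fun f _ => normSq3_le_frobNorm_sq_gnoFollower (η f) (hη f)

/-- The converse comparability, everywhere: `Σ_f ‖gno⁺(η_f) − 1‖²_F ≤ 2·Σ_f |η_f|²`. [folklore] -/
theorem sum_frobNorm_sq_le_two_mul_sum_normSq3 (η : Fol L → Fin 3 → ℝ) :
    ∑ f : Fol L, frobNorm (((quatToSU2 (gnoLetter true (η f)) : SU2) : Matrix (Fin 2) (Fin 2) ℂ) - 1) ^ 2 ≤ 2 * ∑ f, normSq3 (η f) := by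
  rw [Finset.mul_sum]
  exact Finset.sum_le_sum fun f _ => (gnoFollower_frobNorm_sq_bounds (η f)).2

/-- ★★★ **FOLLOWER GROWTH IN GNOMONIC COORDINATES, every sector, every base point**: on the unit sup-box `(∀ f, |η_f|² ≤ 1)`,
`(2304·L⁶·|Fol L|)⁻¹·Σ_f |η_f|² ≤ F̂_z(C, gno⁺(η))`. [cite: Luscher1983, §2] -/
theorem gnoFollower_growth_twisted (z : Fin 3 → Bool) (C : Fin 4 → SU2) (η : Fol L → Fin 3 → ℝ) (hη : ∀ f, normSq3 (η f) ≤ 1) :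
    (2304 * (L : ℝ) ^ 6 * (Fintype.card (Fol L) : ℝ))⁻¹ * ∑ f, normSq3 (η f) ≤
      chartDeficit L z (fun x => centreElem (Bool.xor (z 0 && decide (x 0 ≠ 0)) (Bool.xor (z 1 && decide (x 1 ≠ 0)) (z 2 && decide (x 2 ≠ 0)))))
        (C, fun f => quatToSU2 (gnoLetter true (η f))) := by
  have hL : (0 : ℝ) < L := by exact_mod_cast NeZero.pos L
  have h1 := chartDeficit_twisted_ge_sum_follower_frobNorm_sq (L := L) z (C, fun f => quatToSU2 (gnoLetter true (η f)))
  exact le_trans (mul_le_mul_of_nonneg_left (sum_normSq3_le_sum_frobNorm_sq η hη) (by positivity)) h1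

/-- ★★★ **The principal-sector twin** (`χ ≡ 1`). [cite: Luscher1983, §2] -/
theorem gnoFollower_growth (C : Fin 4 → SU2) (η : Fol L → Fin 3 → ℝ) (hη : ∀ f, normSq3 (η f) ≤ 1) :
    (2304 * (L : ℝ) ^ 6 * (Fintype.card (Fol L) : ℝ))⁻¹ * ∑ f, normSq3 (η f) ≤
      chartDeficit L (fun _ => false) (fun _ => 1) (C, fun f => quatToSU2 (gnoLetter true (η f))) := by
  have hL : (0 : ℝ) < L := by exact_mod_cast NeZero.pos L
  have h1 := chartDeficit_ge_sum_follower_frobNorm_sq (L := L) (C, fun f => quatToSU2 (gnoLetter true (η f)))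
  exact le_trans (mul_le_mul_of_nonneg_left (sum_normSq3_le_sum_frobNorm_sq η hη) (by positivity)) h1

/-! ## §3 The box of a small-deficit point in gnomonic coordinates; the minimiser's sup-box -/

/-- ★★ **Small deficit ⟹ all follower coordinates in the box `|η_f|² ≤ 2304·L⁶·F̂_z`** (every sector; needs `2304L⁶F̂_z ≤ 1`):
✓`chartBox_of_chartDeficit_twisted` (`‖U_f − 1‖_F ≤ 48L³√F̂_z`) read through `normSq3_le_of_frobNorm_gnoFollower_le`. [cite: Luscher1983, §2] -/
theorem gnoFollower_normSq3_le_of_chartDeficit_twisted (z : Fin 3 → Bool) (C : Fin 4 → SU2) (η : Fol L → Fin 3 → ℝ)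
    (hsmall : 2304 * (L : ℝ) ^ 6 * chartDeficit L z
      (fun x => centreElem (Bool.xor (z 0 && decide (x 0 ≠ 0)) (Bool.xor (z 1 && decide (x 1 ≠ 0)) (z 2 && decide (x 2 ≠ 0)))))
        (C, fun f => quatToSU2 (gnoLetter true (η f))) ≤ 1) (f : Fol L) :
    normSq3 (η f) ≤ 2304 * (L : ℝ) ^ 6 * chartDeficit L z
      (fun x => centreElem (Bool.xor (z 0 && decide (x 0 ≠ 0)) (Bool.xor (z 1 && decide (x 1 ≠ 0)) (z 2 && decide (x 2 ≠ 0)))))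
        (C, fun f => quatToSU2 (gnoLetter true (η f))) := by
  set F := chartDeficit L z
      (fun x => centreElem (Bool.xor (z 0 && decide (x 0 ≠ 0)) (Bool.xor (z 1 && decide (x 1 ≠ 0)) (z 2 && decide (x 2 ≠ 0)))))
        (C, fun f => quatToSU2 (gnoLetter true (η f))) with hFdef
  have hF : 0 ≤ F := chartDeficit_nonneg z _ _
  obtain ⟨-, -, hU⟩ := chartBox_of_chartDeficit_twisted (L := L) z (C, fun f => quatToSU2 (gnoLetter true (η f)))
  have h := hU f
  have e : (48 * (L : ℝ) ^ 3 * Real.sqrt F) ^ 2 = 2304 * (L : ℝ) ^ 6 * F := by rw [mul_pow, mul_pow, Real.sq_sqrt hF]; ring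
  have hr : (48 * (L : ℝ) ^ 3 * Real.sqrt F) ^ 2 ≤ 1 := by rw [e]; exact hsmall
  have := normSq3_le_of_frobNorm_gnoFollower_le (η f) hr h
  rwa [e] at this

/-- ★★ **The principal-sector twin** (`χ ≡ 1`). [cite: Luscher1983, §2] -/
theorem gnoFollower_normSq3_le_of_chartDeficit (C : Fin 4 → SU2) (η : Fol L → Fin 3 → ℝ)
    (hsmall : 2304 * (L : ℝ) ^ 6 * chartDeficit L (fun _ => false) (fun _ => 1) (C, fun f => quatToSU2 (gnoLetter true (η f))) ≤ 1) (f : Fol L) :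
    normSq3 (η f) ≤ 2304 * (L : ℝ) ^ 6 * chartDeficit L (fun _ => false) (fun _ => 1) (C, fun f => quatToSU2 (gnoLetter true (η f))) := by
  set F := chartDeficit L (fun _ => false) (fun _ => 1) (C, fun f => quatToSU2 (gnoLetter true (η f))) with hFdef
  have hF : 0 ≤ F := chartDeficit_nonneg _ _ _
  obtain ⟨-, -, hU⟩ := chartBox_of_chartDeficit (L := L) (C, fun f => quatToSU2 (gnoLetter true (η f)))
  have h := hU f
  have e : (48 * (L : ℝ) ^ 3 * Real.sqrt F) ^ 2 = 2304 * (L : ℝ) ^ 6 * F := by rw [mul_pow, mul_pow, Real.sq_sqrt hF]; ring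
  have hr : (48 * (L : ℝ) ^ 3 * Real.sqrt F) ^ 2 ≤ 1 := by rw [e]; exact hsmall
  have := normSq3_le_of_frobNorm_gnoFollower_le (η f) hr h
  rwa [e] at this

/-- ★★ **(T1) THE GNOMONIC MINIMISER SITS IN THE SUP-BOX OF RADIUS `48L³√m`** (every sector): on the near-flat base (`F̂_z(C,1) < 1/(576L⁶)`, which also gives
`2304L⁶·m ≤ 2304L⁶·F̂_z(C,1) < 4`… we ask the cleaner `2304·L⁶·F̂_z(C,1) ≤ 1`) there is a gnomonic minimiser `η₀` of `F̂_z(C,·)` over all of `SU(2)^{Fol L}` with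
`|η₀_f|² ≤ 2304·L⁶·m_z(C)` for every follower, `m_z(C) = F̂_z(C, gno⁺(η₀)) = ⨅_U F̂_z(C,U)`. [cite: Luscher1983, §2] -/
theorem exists_gnoMinimiser_in_box_twisted (z : Fin 3 → Bool) (C : Fin 4 → SU2)
    (hflat : 2304 * (L : ℝ) ^ 6 * chartDeficit L z
      (fun x => centreElem (Bool.xor (z 0 && decide (x 0 ≠ 0)) (Bool.xor (z 1 && decide (x 1 ≠ 0)) (z 2 && decide (x 2 ≠ 0))))) (C, fun _ => 1) ≤ 1) :
    ∃ η₀ : Fol L → Fin 3 → ℝ,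
      (∀ U : Fol L → SU2,
        chartDeficit L z (fun x => centreElem (Bool.xor (z 0 && decide (x 0 ≠ 0)) (Bool.xor (z 1 && decide (x 1 ≠ 0)) (z 2 && decide (x 2 ≠ 0)))))
            (C, fun f => quatToSU2 (gnoLetter true (η₀ f))) ≤
          chartDeficit L z (fun x => centreElem (Bool.xor (z 0 && decide (x 0 ≠ 0)) (Bool.xor (z 1 && decide (x 1 ≠ 0)) (z 2 && decide (x 2 ≠ 0))))) (C, U)) ∧
      ∀ f, normSq3 (η₀ f) ≤ 2304 * (L : ℝ) ^ 6 * chartDeficit L z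
        (fun x => centreElem (Bool.xor (z 0 && decide (x 0 ≠ 0)) (Bool.xor (z 1 && decide (x 1 ≠ 0)) (z 2 && decide (x 2 ≠ 0)))))
          (C, fun f => quatToSU2 (gnoLetter true (η₀ f))) := by
  have hL : (0 : ℝ) < L := by exact_mod_cast NeZero.pos L
  have hL6 : (1 : ℝ) ≤ 2304 * (L : ℝ) ^ 6 := by
    have : (1 : ℝ) ≤ (L : ℝ) ^ 6 := one_le_pow₀ (by exact_mod_cast NeZero.one_le)
    nlinarith
  have hflat' : chartDeficit L z
      (fun x => centreElem (Bool.xor (z 0 && decide (x 0 ≠ 0)) (Bool.xor (z 1 && decide (x 1 ≠ 0)) (z 2 && decide (x 2 ≠ 0))))) (C, fun _ => 1) <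
        1 / (576 * (L : ℝ) ^ 6) := by
    have hF0 := chartDeficit_nonneg (L := L) z
      (fun x : Site 3 L => centreElem (Bool.xor (z 0 && decide (x 0 ≠ 0)) (Bool.xor (z 1 && decide (x 1 ≠ 0)) (z 2 && decide (x 2 ≠ 0))))) (C, fun _ => 1)
    rw [lt_div_iff₀ (by positivity)]
    nlinarith
  obtain ⟨η₀, hη₀⟩ := exists_follower_minimiser_gnomonic_twisted (L := L) z C hflat'
  refine ⟨η₀, hη₀, fun f => gnoFollower_normSq3_le_of_chartDeficit_twisted z C η₀ ?_ f⟩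
  exact le_trans (mul_le_mul_of_nonneg_left (hη₀ fun _ => 1) (by positivity)) hflat

end Summit.QuantumFields.YangMills.Theorems.SwapVirialDeficit.BlowUpRing

end
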